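import Mathlib
import Literature.AlgebraicGeometry.Resolution.BlowupChartRsop
import Literature.AlgebraicGeometry.Resolution.AffineBlowupAlgebra
import Literature.AlgebraicGeometry.Resolution.QuadraticTransformAlongPrime
import Literature.AlgebraicGeometry.Resolution.CurveDeltaInvariant
import HarnessLib

/-!
# The local rings of the blowing up of a point of a curve, as subrings of the function field

Topic: `Literature/AlgebraicGeometry/Resolution`. Ring-level infrastructure for the `δ`-drop
theorem (Kollár 2007, §1.4; the input "by embedded resolution of curves" of Cossart–Piltant 2008,
proof of Prop. 4.4): for a local domain `(R, 𝔪)` with fraction field `K`, generators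
`𝔪 = (c₁, …, c_n)` and the chart ring `B_j = R[𝔪/c_j]` of `Bl_𝔪(Spec R)` (`chartRing c j`,
`BlowupChartRsop.lean`; `= (R[𝔪t])_{(c_j t)}`), the local rings `(B_j)_𝔴` at primes over `𝔪`
embed CANONICALLY into `K`, and their images `S ⊆ K` (`pointSubalgebra`) are the intermediate
rings `R ⊆ S ⊆ K` to which `CurveDeltaDrop.lean` applies. All PROVED:

* `curveDelta_eq_of_ringEquiv`, `module_finite_integralClosure_of_ringEquiv` — `δ` and the
  finiteness of the normalization are invariant under ring isomorphisms;
* `chartEmb K c j` — the embedding `B_j → K` (the case `θ = (R ⊆ K)` of `chartToField` of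
  `QuadraticTransformAlongPrime.lean`), `chartEmb_injective`, `ringHom_ext_chartBase` — **a ring
  homomorphism from `B_j` to a domain is determined by its restriction to `R`** (as soon as
  `c_j ↦` non-zero; via `exists_pow_mul_eq_reesChartBase`);
* `locEmb` — the canonical embedding `(B_j)_𝔴 → K` for ANY prime `𝔴`, `locEmb_injective`,
  `locEmb_unique` (uniqueness among `R`-compatible maps), `pointSubalgebra` — its image, with
  `pointSubalgebraEquiv : L ≃+* pointSubalgebra`;
* `exists_mem_pointSubalgebra_eq_mul` — **`𝔪 ⊆ c_j · S`** (`𝔪 B_j = c_j B_j`, Stacks 07Z3 (2)).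

## Sources

* J. Kollár, *Lectures on Resolution of Singularities* (2007), §1.4. [Kollar2007]
* The Stacks Project, Tag 0804, Tag 07Z3. [StacksProject]
-/

noncomputable section

open IsLocalRing

namespace Literature.AlgebraicGeometry.Resolution

universe u

/-! ## `δ` along ring isomorphisms -/

section Transport

/-- **`δ` is invariant under ring isomorphisms** (with any fraction fields). [folklore] -/
theorem curveDelta_eq_of_ringEquiv {R R' : Type u} [CommRing R] [IsDomain R] [CommRing R']
    [IsDomain R'] (e : R ≃+* R') (K K' : Type u) [Field K] [Algebra R K] [IsFractionRing R K]
    [Field K'] [Algebra R' K'] [IsFractionRing R' K'] : curveDelta R K = curveDelta R' K' := by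
  classical
  -- transport the `R'`-structure on `K'` back to `R`
  letI : Algebra R R' := e.toRingHom.toAlgebra
  letI algRK' : Algebra R K' := ((algebraMap R' K').comp e.toRingHom).toAlgebra
  haveI : IsScalarTower R R' K' := IsScalarTower.of_algebraMap_eq fun _ => rfl
  haveI : IsFractionRing R K' := by
    have h := (IsFractionRing.isFractionRing_iff_of_base_ringEquiv (R := R') (S := K') e.symm).mp
      inferInstance
    rw [RingEquiv.symm_symm] at h
    exact h
  rw [curveDelta_eq_curveDelta (R := R) K K']
  -- now compare `δ` over `R` and over `R'` inside `K'`
  -- the `R`-linear identification of the normalizations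
  let f : integralClosure R K' ≃ₗ[R] integralClosure R' K' :=
    { toFun := fun x => ⟨x, (RingEquiv.isIntegral_iff (S := K') e rfl (x : K')).mp x.2⟩
      invFun := fun x => ⟨x, (RingEquiv.isIntegral_iff (S := K') e rfl (x : K')).mpr x.2⟩
      map_add' := fun _ _ => rfl
      map_smul' := fun r x => Subtype.ext (by
        change algebraMap R K' r * (x : K') = r • (x : K')
        rw [Algebra.smul_def])
      left_inv := fun _ => rfl
      right_inv := fun _ => rfl }
  have hmap : (baseSubmodule R K').map f.toLinearMap =
      (baseSubmodule R' K').restrictScalars R := by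
    apply le_antisymm
    · rintro _ ⟨w, hw, rfl⟩
      obtain ⟨r, rfl⟩ := (mem_baseSubmodule_iff R K').mp hw
      refine (mem_baseSubmodule_iff R' K').mpr ⟨e r, Subtype.ext ?_⟩
      rfl
    · intro w hw
      obtain ⟨r', hr'⟩ := (mem_baseSubmodule_iff R' K').mp hw
      refine ⟨algebraMap R _ (e.symm r'), (mem_baseSubmodule_iff R K').mpr ⟨_, rfl⟩, ?_⟩
      apply Subtype.ext
      change algebraMap R' K' (e (e.symm r')) = (w : K')
      rw [e.apply_symm_apply, ← hr']
      rfl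
  have e1 := (Submodule.Quotient.equiv (baseSubmodule R K') _ f hmap).length_eq
  rw [curveDelta, e1, (Submodule.Quotient.restrictScalarsEquiv R (baseSubmodule R' K')).length_eq,
    curveDelta]
  exact Module.length_eq_of_surjective (S := R) (R := R') e.surjective

/-- Finiteness of the normalization does not depend on the chosen fraction field (two arbitrary
fraction fields). [folklore] -/
theorem module_finite_integralClosure_of_isFractionRing' {R : Type u} [CommRing R] (K₁ K₂ : Type*)
    [Field K₁] [Algebra R K₁] [IsFractionRing R K₁] [Field K₂] [Algebra R K₂] [IsFractionRing R K₂]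
    [Module.Finite R (integralClosure R K₁)] : Module.Finite R (integralClosure R K₂) :=
  Module.Finite.equiv
    (((FractionRing.algEquiv R K₁).symm.trans (FractionRing.algEquiv R K₂)).mapIntegralClosure).toLinearEquiv

/-- **Finiteness of the normalization is invariant under ring isomorphisms.** [folklore] -/
theorem module_finite_integralClosure_of_ringEquiv {R R' : Type u} [CommRing R] [CommRing R']
    (e : R ≃+* R') (K K' : Type u) [Field K] [Algebra R K] [IsFractionRing R K]
    [Field K'] [Algebra R' K'] [IsFractionRing R' K'] [Module.Finite R (integralClosure R K)] :
    Module.Finite R' (integralClosure R' K') := by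
  letI : Algebra R R' := e.toRingHom.toAlgebra
  letI algRK' : Algebra R K' := ((algebraMap R' K').comp e.toRingHom).toAlgebra
  haveI : IsScalarTower R R' K' := IsScalarTower.of_algebraMap_eq fun _ => rfl
  haveI : IsFractionRing R K' := by
    have h := (IsFractionRing.isFractionRing_iff_of_base_ringEquiv (R := R') (S := K') e.symm).mp
      inferInstance
    rw [RingEquiv.symm_symm] at h
    exact h
  haveI : Module.Finite R (integralClosure R K') :=
    module_finite_integralClosure_of_isFractionRing' K K'
  let f : integralClosure R K' ≃ₗ[R] integralClosure R' K' :=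
    { toFun := fun x => ⟨x, (RingEquiv.isIntegral_iff (S := K') e rfl (x : K')).mp x.2⟩
      invFun := fun x => ⟨x, (RingEquiv.isIntegral_iff (S := K') e rfl (x : K')).mpr x.2⟩
      map_add' := fun _ _ => rfl
      map_smul' := fun r x => Subtype.ext (by
        change algebraMap R K' r * (x : K') = r • (x : K')
        rw [Algebra.smul_def])
      left_inv := fun _ => rfl
      right_inv := fun _ => rfl }
  haveI : Module.Finite R (integralClosure R' K') := Module.Finite.equiv f
  exact Module.Finite.of_restrictScalars_finite R R' _

end Transport

/-! ## The chart ring inside the fraction field -/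

section Chart

variable {R : Type u} [CommRing R] [IsDomain R] (K : Type u) [Field K] [Algebra R K]
  [IsFractionRing R K] {n : ℕ} (c : Fin n → R) (j : Fin n)

omit [IsDomain R] in
/-- `c_j ≠ 0` in `K`. [folklore] -/
theorem algebraMap_apply_ne_zero (hcj : c j ≠ 0) : algebraMap R K (c j) ≠ 0 :=
  fun h => hcj (IsFractionRing.injective R K (by rw [h, map_zero]))

/-- **The canonical embedding `B_j → K`** of the chart ring `B_j = R[𝔪/c_j]` (`chartRing c j`)
into the fraction field, `b ↦ ψ(b) ∈ R[1/c_j] ⊆ K`: the case `θ = (R ⊆ K)` of `chartToField`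
(`QuadraticTransformAlongPrime.lean`). [cite: StacksProject, Tag 07Z3] -/
abbrev chartEmb (hcj : c j ≠ 0) : chartRing c j →+* K :=
  chartToField c j (algebraMap R K) (algebraMap_apply_ne_zero K c j hcj)

omit [IsDomain R] in
/-- `chartEmb ∘ φ = (R → K)` (`chartToField_reesChartBase`). [folklore] -/
theorem chartEmb_chartBase (hcj : c j ≠ 0) (r : R) :
    chartEmb K c j hcj (chartBase c j r) = algebraMap R K r :=
  chartToField_reesChartBase c j (algebraMap R K) _ r

/-- `chartEmb` is injective: if `ψ(b) = 0` then, writing `φ(c_j)^k b = φ(r)`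
(`exists_pow_mul_eq_reesChartBase`), `r = 0` (`chartToField_ne_zero_iff`) and `b = 0` as `φ(c_j)`
is a non-zero-divisor. [cite: StacksProject, Tag 07Z3] -/
theorem chartEmb_injective (hcj : c j ≠ 0) : Function.Injective (chartEmb K c j hcj) := by
  have hmem := Ideal.mem_span_range_self (f := c) (x := j)
  haveI : IsDomain (Localization.Away (c j)) :=
    IsLocalization.isDomain_localization (powers_le_nonZeroDivisors_of_noZeroDivisors hcj)
  refine (injective_iff_map_eq_zero _).mpr fun b hb => ?_
  obtain ⟨k, r, h⟩ := exists_pow_mul_eq_reesChartBase c j b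
  have hr : algebraMap R K r = 0 := by
    by_contra hr
    exact ((chartToField_ne_zero_iff c j (algebraMap R K) (algebraMap_apply_ne_zero K c j hcj)
      h).mpr hr) hb
  have hr0 : r = 0 := IsFractionRing.injective R K (by rw [hr, map_zero])
  rw [hr0, map_zero] at h
  -- apply the (injective) chart map `ψ : B_j → R[1/c_j]`, a domain
  apply reesChart_injective (c j) hmem
  have h' := congrArg (reesChart (c j) hmem) h
  rw [RingHom.map_mul, RingHom.map_pow, reesChart_reesChartBase, map_zero] at h'
  rw [map_zero]
  refine (mul_eq_zero.mp h').resolve_left (pow_ne_zero k ?_)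
  exact fun h0 => hcj ((IsLocalization.to_map_eq_zero_iff (S := Localization.Away (c j))
    (powers_le_nonZeroDivisors_of_noZeroDivisors hcj)).mp h0)

omit [IsDomain R] in
/-- **A ring homomorphism from `B_j` to a domain is determined by its restriction to `R`** (as soon
as `c_j` does not map to zero). [folklore] -/
theorem ringHom_ext_chartBase {A : Type*} [CommRing A] [IsDomain A] {g₁ g₂ : chartRing c j →+* A}
    (h : g₁.comp (chartBase c j) = g₂.comp (chartBase c j)) (h0 : g₁ (chartBase c j (c j)) ≠ 0) :
    g₁ = g₂ := by
  refine RingHom.ext fun b => ?_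
  obtain ⟨N, r, hb⟩ := exists_pow_mul_eq_reesChartBase c j b
  have h1 := congrArg g₁ hb
  have h2 := congrArg g₂ hb
  rw [RingHom.map_mul, RingHom.map_pow] at h1 h2
  have hr : g₁ (chartBase c j r) = g₂ (chartBase c j r) := RingHom.congr_fun h r
  have hc : g₁ (chartBase c j (c j)) = g₂ (chartBase c j (c j)) := RingHom.congr_fun h (c j)
  change g₁ (chartBase c j (c j)) ^ N * g₁ b = g₁ (chartBase c j r) at h1
  change g₂ (chartBase c j (c j)) ^ N * g₂ b = g₂ (chartBase c j r) at h2
  rw [hr, ← h2, hc] at h1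
  exact mul_left_cancel₀ (pow_ne_zero N (hc ▸ h0)) h1

/-- The chart ring of a domain is a domain (it embeds into the fraction field). [folklore] -/
theorem isDomain_chartRing (hcj : c j ≠ 0) : IsDomain (chartRing c j) :=
  Function.Injective.isDomain _ (chartEmb_injective (FractionRing R) c j hcj)

end Chart

/-! ## The local rings of the chart inside the fraction field -/

section AtPrime

variable {R : Type u} [CommRing R] [IsDomain R] (K : Type u) [Field K] [Algebra R K]
  [IsFractionRing R K] {n : ℕ} (c : Fin n → R) (j : Fin n) (hcj : c j ≠ 0)

/-- **The canonical embedding `(B_j)_𝔴 → K`.** [folklore] -/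
def locEmb (𝔴 : Ideal (chartRing c j)) [𝔴.IsPrime]
    (L : Type u) [CommRing L] [Algebra (chartRing c j) L] [IsLocalization.AtPrime L 𝔴] : L →+* K :=
  IsLocalization.lift (M := 𝔴.primeCompl) (g := chartEmb K c j hcj) fun s =>
    isUnit_iff_ne_zero.mpr fun h => s.2 (by
      have : (s : chartRing c j) = 0 :=
        chartEmb_injective K c j hcj (by rw [h, map_zero])
      rw [this]; exact 𝔴.zero_mem)

/-- `locEmb` on `B_j`. [folklore] -/
theorem locEmb_algebraMap (𝔴 : Ideal (chartRing c j)) [𝔴.IsPrime]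
    (L : Type u) [CommRing L] [Algebra (chartRing c j) L] [IsLocalization.AtPrime L 𝔴] (b : chartRing c j) :
    locEmb K c j hcj 𝔴 L ((algebraMap (chartRing c j) L : chartRing c j →+* L) b) = chartEmb K c j hcj b :=
  IsLocalization.lift_eq (M := 𝔴.primeCompl) _ b

/-- `locEmb` on `R`. [folklore] -/
theorem locEmb_chartBase (𝔴 : Ideal (chartRing c j)) [𝔴.IsPrime]
    (L : Type u) [CommRing L] [Algebra (chartRing c j) L] [IsLocalization.AtPrime L 𝔴] (r : R) :
    locEmb K c j hcj 𝔴 L ((algebraMap (chartRing c j) L : chartRing c j →+* L) (chartBase c j r)) = algebraMap R K r := by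
  rw [locEmb_algebraMap, chartEmb_chartBase K c j hcj]

/-- `locEmb` is injective. [folklore] -/
theorem locEmb_injective (𝔴 : Ideal (chartRing c j)) [𝔴.IsPrime]
    (L : Type u) [CommRing L] [Algebra (chartRing c j) L] [IsLocalization.AtPrime L 𝔴] :
    Function.Injective (locEmb K c j hcj 𝔴 L) := by
  refine (IsLocalization.lift_injective_iff _).mpr fun x y => ⟨fun h => ?_, fun h => ?_⟩
  · obtain ⟨s, hs⟩ := IsLocalization.exists_of_eq (M := 𝔴.primeCompl) h
    have hs0 : chartEmb K c j hcj s ≠ 0 := fun h0 => s.2 (by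
      have : (s : chartRing c j) = 0 :=
        chartEmb_injective K c j hcj (by rw [h0, map_zero])
      rw [this]; exact 𝔴.zero_mem)
    have := congrArg (chartEmb K c j hcj) hs
    rw [map_mul, map_mul] at this
    exact mul_left_cancel₀ hs0 this
  · rw [chartEmb_injective K c j hcj h]

/-- **Uniqueness**: a ring homomorphism `(B_j)_𝔴 → K` compatible with `R → K` is the canonical
embedding. [folklore] -/
theorem locEmb_unique (𝔴 : Ideal (chartRing c j)) [𝔴.IsPrime]
    (L : Type u) [CommRing L] [Algebra (chartRing c j) L] [IsLocalization.AtPrime L 𝔴] (f : L →+* K)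
    (hf : f.comp (((algebraMap (chartRing c j) L : chartRing c j →+* L)).comp (chartBase c j)) = algebraMap R K) :
    f = locEmb K c j hcj 𝔴 L := by
  refine IsLocalization.ringHom_ext 𝔴.primeCompl (ringHom_ext_chartBase c j ?_ ?_)
  · rw [RingHom.comp_assoc, hf]
    ext r
    rw [RingHom.comp_apply, RingHom.comp_apply, locEmb_chartBase]
  · rw [RingHom.comp_apply, show f ((algebraMap (chartRing c j) L : chartRing c j →+* L) (chartBase c j (c j))) =
      algebraMap R K (c j) from RingHom.congr_fun hf (c j)]
    exact fun h => hcj (IsFractionRing.injective R K (by rw [h, map_zero]))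

/-- **The local ring `(B_j)_𝔴` as a subring `S ⊆ K`** containing `R`: the image of the canonical
embedding. [cite: Kollar2007, §1.4] -/
def pointSubalgebra (𝔴 : Ideal (chartRing c j)) [𝔴.IsPrime]
    (L : Type u) [CommRing L] [Algebra (chartRing c j) L] [IsLocalization.AtPrime L 𝔴] : Subalgebra R K where
  carrier := Set.range (locEmb K c j hcj 𝔴 L)
  mul_mem' := by
    rintro _ _ ⟨a, rfl⟩ ⟨b, rfl⟩
    exact ⟨a * b, map_mul _ _ _⟩
  one_mem' := ⟨1, map_one _⟩
  add_mem' := by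
    rintro _ _ ⟨a, rfl⟩ ⟨b, rfl⟩
    exact ⟨a + b, map_add _ _ _⟩
  zero_mem' := ⟨0, map_zero _⟩
  algebraMap_mem' r := ⟨_, locEmb_chartBase K c j hcj 𝔴 L r⟩

/-- Membership in `pointSubalgebra`. [folklore] -/
theorem mem_pointSubalgebra_iff (𝔴 : Ideal (chartRing c j)) [𝔴.IsPrime]
    (L : Type u) [CommRing L] [Algebra (chartRing c j) L] [IsLocalization.AtPrime L 𝔴] {z : K} :
    z ∈ pointSubalgebra K c j hcj 𝔴 L ↔ ∃ x : L, locEmb K c j hcj 𝔴 L x = z := by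
  change z ∈ Set.range (locEmb K c j hcj 𝔴 L) ↔ _
  exact Iff.rfl

/-- `(B_j)_𝔴 ≅ S`. [folklore] -/
def pointSubalgebraEquiv (𝔴 : Ideal (chartRing c j)) [𝔴.IsPrime]
    (L : Type u) [CommRing L] [Algebra (chartRing c j) L] [IsLocalization.AtPrime L 𝔴] :
    L ≃+* pointSubalgebra K c j hcj 𝔴 L :=
  RingEquiv.ofBijective
    ({ toFun := fun x => ⟨locEmb K c j hcj 𝔴 L x, (mem_pointSubalgebra_iff K c j hcj 𝔴 L).mpr ⟨x, rfl⟩⟩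
       map_one' := Subtype.ext (map_one _)
       map_mul' := fun _ _ => Subtype.ext (map_mul _ _ _)
       map_zero' := Subtype.ext (map_zero _)
       map_add' := fun _ _ => Subtype.ext (map_add _ _ _) } : L →+* pointSubalgebra K c j hcj 𝔴 L)
    ⟨fun x y h => locEmb_injective K c j hcj 𝔴 L (congrArg Subtype.val h),
      fun z => by
        obtain ⟨x, hx⟩ := (mem_pointSubalgebra_iff K c j hcj 𝔴 L).mp z.2
        exact ⟨x, Subtype.ext hx⟩⟩

/-- `pointSubalgebraEquiv` followed by the inclusion into `K` is `locEmb`. [folklore] -/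
theorem coe_pointSubalgebraEquiv (𝔴 : Ideal (chartRing c j)) [𝔴.IsPrime]
    (L : Type u) [CommRing L] [Algebra (chartRing c j) L] [IsLocalization.AtPrime L 𝔴] (x : L) :
    (pointSubalgebraEquiv K c j hcj 𝔴 L x).1 = locEmb K c j hcj 𝔴 L x := rfl

/-- **`𝔪 ⊆ c_j · S`**: every element of `I = (c₁, …, c_n)` is divisible by `c_j` in `S`
(`I B_j = c_j B_j`, Stacks 07Z3 (2)). [cite: StacksProject, Tag 07Z3] -/
theorem exists_mem_pointSubalgebra_eq_mul (𝔴 : Ideal (chartRing c j)) [𝔴.IsPrime]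
    (L : Type u) [CommRing L] [Algebra (chartRing c j) L] [IsLocalization.AtPrime L 𝔴] {m : R} (hm : m ∈ Ideal.span (Set.range c)) :
    ∃ b ∈ pointSubalgebra K c j hcj 𝔴 L, algebraMap R K m = algebraMap R K (c j) * b := by
  have hmem := Ideal.mem_span_range_self (f := c) (x := j)
  have h1 : chartBase c j m ∈ Ideal.span (reesChartBase (c j) hmem '' (Ideal.span (Set.range c) : Set R)) :=
    Ideal.subset_span ⟨m, hm, rfl⟩
  rw [span_image_reesChartBase_eq] at h1
  obtain ⟨b₀, hb₀⟩ := Ideal.mem_span_singleton'.mp h1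
  refine ⟨locEmb K c j hcj 𝔴 L ((algebraMap (chartRing c j) L : chartRing c j →+* L) b₀),
    (mem_pointSubalgebra_iff K c j hcj 𝔴 L).mpr ⟨_, rfl⟩, ?_⟩
  have key : chartBase c j m = chartBase c j (c j) * b₀ := by
    rw [← hb₀]; exact mul_comm b₀ _
  rw [← locEmb_chartBase K c j hcj 𝔴 L m, key, map_mul, map_mul, locEmb_chartBase]

end AtPrime


end Literature.AlgebraicGeometry.Resolution

end
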